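import Mathlib
import HarnessLib
import Summits.HubbardSuperconductivity.HubbardSuperconductivity.Theorems.KLProgrammeC4aFoldBoxPreLaw

/-!
# Route `KLProgramme` — crux C4a, S3 brick (B4) «(U1)-LAWS» part 5g: the PRE-CAUSTIC (N2) FIRST-ORDER LAW FOR THE PARTNER BAND ON THE FERMI STRIP `|e| ≤ lo` —
# `∫dy |∫_{−lo}^{lo} w·X·∂_uK(e, ē(e,y)) de| ≤ A⁰·lo·(m₀⁻¹(√m₀)⁻¹)`: the strip of loop levels within the scale floor is `hpre`-shaped from the SCALE-REGULAR envelope alone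

Cell `gate-hubbard-kl`, seat hubbard-kl-k3c3-p3 (g32; row «implicit-function / monotonicity route for μ(n)»).  Located brick for the (C)-closer lane / the (M4)
assembly of the umklapp first-order ϑ-layer (stub (C) `stub_twoLeg_curvature` of `KLRegimeEngineV17F2`, stmt-HubbardSuperconductivity-20437), memo
HOME/hubbard-kl-k3c3-p3/U1-CAUSTIC-SUP.md §12 («(U1)-NEG-PRE», the strip).

WHY.  Part 5d prices loop levels `e ∈ [lo,hi]` (flatness number, `lo ≍ Λ` the scale floor of the kernel), part 5f the levels `−e`, `e ∈ [lo,hi]` (diagonal majorant).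
The remaining STRIP `|e| ≤ lo` needs neither: there the pair kernel is regular at scale `lo` — `|∂ᵤK(e,u)| ≤ 1/max(lo,|u|)²` (normalised; k3c3-p1's (M1) currency:
below the shell only frequencies `|ωₙ| ≳ Λ/2` survive the above-scale weights, so `K` is smooth at scale `Λ`) — and on the PRE side the partner level along the strip
stays `≥ D(y) − 3lo/2` (rate window on `[−lo, lo]`), so `max(lo, ē) ≥ max(D(y),lo)/4` and the level line is at most `2lo·W·X₀·16/max(D(y),lo)²`: the (N2) line shape with
`A₁ = 32WX₀`, `A₂ = A₃ = 0`; the loop-angle layer then gives the `hpre` size with `B = B′ = 0`.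
* §1 **`abs_levelLine_partnerBand_pre_strip_le`**: the level line over `e ∈ [−lo, lo]` at one loop angle `y` with `D(y) > 0`.
* §2 **`intervalIntegral_partnerBand_pre_strip_le`** (HEADLINE): package hypotheses of `…C4aFoldBoxPartnerBandLaws.partnerBand_foldBox_package` + `0 < lo ≤ hi < r` +
  the scale-regular envelope on the strip + weight `|X| ≤ X₀` + profile `0 ≤ w ≤ W` + PRE SIDE `δ₀ > 0` (no continuity / integrability rows: pointwise × length) ⟹
  `∫_{α..β} |∫_{−lo..lo} w(e)·X(e,y)·(K e)′(e_K(S − Φ(e, y+θ))) de| dy ≤ (32·(32WX₀)/(3√c))·(lo·((max |δ₀| lo)⁻¹·(√(max |δ₀| lo))⁻¹))`, `c = w·u_min²/2`.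
With 5d (`+e`), 5f (`−e`) and this strip the `hpre` law covers every loop level `|e| ≤ hi`; the three bounds add up to one `hpre` row for one `F(ϑ)`.
Sizes binder shape + `GeomConstants`; nothing asserts (C), K3 or superconductivity.
References: FST II CPAM 51 (1998) §3 [cite: FeldmanSalmhoferTrubowitz1998]; Salmhofer 1999 §4.5.3 [cite: Salmhofer1999].
-/

noncomputable section

namespace Summit.HubbardSuperconductivity.HubbardSuperconductivity.Theorems.C4a

set_option linter.dupNamespace false -- summit = problem name (single-conjunct summit), D-0017

open Real Set MeasureTheory intervalIntegral
open scoped Interval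
open Literature.MathematicalPhysics.QuantumLattice Literature.MathematicalPhysics.QuantumLattice.BandSectorCounting
open Literature.MathematicalPhysics.QuantumLattice.FermiRG
open Summit.HubbardSuperconductivity.HubbardSuperconductivity.Theorems.KLRegimeSplit
open Summit.HubbardSuperconductivity.HubbardSuperconductivity.Theorems.DispersionFlow
open Summit.HubbardSuperconductivity.HubbardSuperconductivity.Theorems.PerturbedFermiCurve

section Sizes

variable {K : TrigPolyC4v} {A : ℝ} (hA : ∀ p : Momentum, ∀ j ≤ 2, ‖iteratedFDeriv ℝ j (frameShift K) p‖ ≤ A) (hA20 : A ≤ 1 / 20)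
  (hd : klCurveD ≤ (bandBounds (show (-4 : ℝ) < -1.1 by norm_num) (show (-1.1 : ℝ) ≤ -0.1 by norm_num)
    (show (-0.1 : ℝ) < 0 by norm_num)).Dtmin - 2 * A)
  {μ r : ℝ} (hr : 0 < r) (hlo : (-1.1 : ℝ) < μ - r - A) (hhi : μ + r + A < -0.1)
  {A₃ A₄ : ℝ} (hA₃ : ∀ p : Momentum, ‖iteratedFDeriv ℝ 3 (frameShift K) p‖ ≤ A₃)
  (hA₄ : ∀ p : Momentum, ‖iteratedFDeriv ℝ 4 (frameShift K) p‖ ≤ A₄)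
  {K₁ K₂ K₃ : ℝ} (hK₁ : ∀ p : Momentum, ‖fderiv ℝ (frameLevel μ K) p‖ ≤ K₁) (hK₂ : ∀ p : Momentum, ‖iteratedFDeriv ℝ 2 (frameLevel μ K) p‖ ≤ K₂)
  (hK₃ : ∀ p : Momentum, ‖iteratedFDeriv ℝ 3 (frameLevel μ K) p‖ ≤ K₃)
include hA hA20 hd hr hlo hhi hA₃ hA₄ hK₁ hK₂ hK₃

/-! ## §1 The pre-caustic level line of the partner band on the Fermi strip -/

omit hA20 hA₃ hA₄ hK₁ hK₃ in
/-- **THE PRE-CAUSTIC LEVEL LINE ON THE STRIP `|e| ≤ lo`.**  A loop angle `y` with `D(y) = e_K(S − Φ(0, y+θ)) > 0`; the rate window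
`K₂‖S − 2πm − 2Φ(σ, y+θ)‖/(Dt−2A) ≤ 1/2` for `σ ∈ [−lo, lo]`; `0 < lo < r`; kernel `K e` with the scale-regular envelope `|(K e)′u| ≤ 1/max(lo,|u|)²` for `|e| ≤ lo`,
weight `|X| ≤ X₀`; profile `0 ≤ w ≤ W` (no continuity or integrability needed: the bound is pointwise × length).  THEN
`|∫_{−lo..lo} w(e)·X(e)·(K e)′(e_K(S − Φ(e, y+θ))) de| ≤ 32·(W·X₀)·(lo/max(D(y),lo)²)`. -/
theorem abs_levelLine_partnerBand_pre_strip_le (S : Momentum) (m : Fin 2 → ℤ) (θ : ℝ) {y lo X₀ W : ℝ} {Kr : ℝ → ℝ → ℝ} {X wt : ℝ → ℝ}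
    (hD : 0 < frameLevel μ K (S - levelPoint μ K 0 (y + θ)))
    (hlo0 : 0 < lo) (hlor : lo < r)
    (hratey : ∀ σ ∈ Icc (-lo) lo, K₂ * ‖S - WithLp.toLp 2 (fun i => 2 * π * (m i : ℝ)) - (2 : ℝ) • levelPoint μ K σ (y + θ)‖ /
        ((bandBounds (show (-4 : ℝ) < -1.1 by norm_num) (show (-1.1 : ℝ) ≤ -0.1 by norm_num) (show (-0.1 : ℝ) < 0 by norm_num)).Dtmin - 2 * A) ≤ 1 / 2)
    (hK1 : ∀ e ∈ Icc (-lo) lo, ∀ u, |deriv (Kr e) u| ≤ (max lo |u|)⁻¹ ^ 2)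
    (hw0 : ∀ e ∈ Icc (-lo) lo, 0 ≤ wt e) (hwW : ∀ e ∈ Icc (-lo) lo, wt e ≤ W) (hX0 : ∀ e ∈ Icc (-lo) lo, |X e| ≤ X₀) :
    |∫ e in (-lo)..lo, wt e * X e * deriv (Kr e) (frameLevel μ K (S - levelPoint μ K e (y + θ)))| ≤
      32 * (W * X₀) * (lo / (max (frameLevel μ K (S - levelPoint μ K 0 (y + θ))) lo) ^ 2) := by
  set v : Momentum := WithLp.toLp 2 (fun i => 2 * π * (m i : ℝ)) with hv
  set D : ℝ := frameLevel μ K (S - levelPoint μ K 0 (y + θ)) with hDdef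
  set eb : ℝ → ℝ := fun e => frameLevel μ K (S - levelPoint μ K e (y + θ)) with heb
  set M : ℝ := max D lo with hM
  have hMpos : 0 < M := lt_max_of_lt_right hlo0
  have hll : -lo ≤ lo := by linarith
  have h0I : (0 : ℝ) ∈ Icc (-lo) lo := ⟨by linarith, hlo0.le⟩
  have hX00 : 0 ≤ X₀ := (abs_nonneg _).trans (hX0 0 h0I)
  have hW0 : 0 ≤ W := (hw0 0 h0I).trans (hwW 0 h0I)
  -- the partner level along the strip stays `≥ D − 3lo/2`
  have hlow : ∀ e ∈ Icc (-lo) lo, D - 3 / 2 * lo ≤ eb e := fun e he => by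
    rcases le_or_gt 0 e with he0 | he0
    · have h := partnerBand_level_rate_window hA hd hlo hhi hK₂ (frameLevel_add_twoPi μ K m) S (y + θ) he0 (by linarith) (lt_of_le_of_lt he.2 hlor)
        fun σ hσ => hratey σ ⟨by linarith [hσ.1], hσ.2.trans he.2⟩
      rw [heb]; simp only
      linarith [h.1, he.2]
    · have h := partnerBand_level_rate_window hA hd hlo hhi hK₂ (frameLevel_add_twoPi μ K m) S (y + θ) he0.le (by linarith [he.1]) hr
        fun σ hσ => hratey σ ⟨he.1.trans hσ.1, by linarith [hσ.2]⟩
      rw [heb]; simp only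
      linarith [h.2, he.1]
  -- hence the kernel is at most `16/max(D,lo)²` along the line
  have hker : ∀ e ∈ Icc (-lo) lo, |deriv (Kr e) (eb e)| ≤ 16 / M ^ 2 := fun e he => by
    refine (hK1 e he (eb e)).trans ?_
    have hm : M / 4 ≤ max lo |eb e| := by
      rcases le_or_gt D (4 * lo) with h | h
      · have : M ≤ 4 * lo := max_le h (by linarith)
        exact le_max_of_le_left (by linarith)
      · have hMD : M = D := max_eq_left (by linarith)
        refine le_max_of_le_right ?_
        have h1 := hlow e he
        rw [hMD]
        exact le_trans (by linarith) (le_abs_self _)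
    rw [inv_pow, show (16 : ℝ) / M ^ 2 = ((M / 4) ^ 2)⁻¹ by field_simp; norm_num]
    exact inv_anti₀ (by positivity) (pow_le_pow_left₀ (by positivity) hm 2)
  -- no integrability is needed: a constant pointwise bound on the oriented interval suffices
  have hpt : ∀ e ∈ Ι (-lo) lo, ‖wt e * X e * deriv (Kr e) (eb e)‖ ≤ W * X₀ * (16 / M ^ 2) := fun e he => by
    rw [uIoc_of_le hll] at he
    have heI : e ∈ Icc (-lo) lo := Ioc_subset_Icc_self he
    rw [Real.norm_eq_abs, abs_mul, abs_mul, abs_of_nonneg (hw0 e heI)]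
    have h1 : wt e * |X e| ≤ W * X₀ := mul_le_mul (hwW e heI) (hX0 e heI) (abs_nonneg _) hW0
    exact mul_le_mul h1 (hker e heI) (abs_nonneg _) (by positivity)
  have h := intervalIntegral.norm_integral_le_of_norm_le_const hpt
  rw [Real.norm_eq_abs, show |lo - -lo| = 2 * lo by rw [abs_of_nonneg (by linarith)]; ring] at h
  refine h.trans (le_of_eq ?_)
  rw [hM]
  field_simp
  ring

/-! ## §2 The pre-caustic (N2) law on the Fermi strip -/

/-- **THE PRE-CAUSTIC (N2) FIRST-ORDER LAW FOR THE PARTNER BAND ON THE FERMI STRIP** (HEADLINE; see the module docstring).  The value has the dispatchers' `hpre`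
shape with `A = 32·(32WX₀)/(3√c)`, `B = B′ = 0`, `c = w·u_min²/2`. -/
theorem intervalIntegral_partnerBand_pre_strip_le {Kc r₀ g₀ w : ℝ} (hG : GeomConstants (frameLevel μ K) Kc r₀ g₀ w) (S : Momentum) (m : Fin 2 → ℤ) (θ : ℝ)
    {α β x₀ Wm Wφ lo hi X₀ W : ℝ} {Kr X : ℝ → ℝ → ℝ} {wt : ℝ → ℝ}
    (hx₀ : x₀ ∈ Icc α β) (hWα : Wm ≤ x₀ - α) (hWβ : Wm ≤ β - x₀) (hWφ : ∀ y ∈ Icc α β, |y - x₀| ≤ Wφ)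
    (hlo0 : 0 < lo) (hlohi : lo ≤ hi) (hhir : hi < r)
    (hδ₀ : 0 < sInf ((fun x : ℝ => frameLevel μ K (S - levelPoint μ K 0 (x + θ))) '' Icc α β))
    (hwin : ∀ e ∈ Icc (-hi) hi, ∀ y ∈ Icc α β,
      K₃ * (‖S - WithLp.toLp 2 (fun i => 2 * π * (m i : ℝ)) - (levelPoint μ K 0 (x₀ + θ) + levelPoint μ K 0 (x₀ + θ))‖ +
              |e| / ((bandBounds (show (-4 : ℝ) < -1.1 by norm_num) (show (-1.1 : ℝ) ≤ -0.1 by norm_num) (show (-0.1 : ℝ) < 0 by norm_num)).Dtmin - 2 * A) +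
              msD A₃ A₄ 1 * |y - x₀|) * msD A₃ A₄ 1 ^ 2 +
          K₂ * (radialRowOneConst A ((bandBounds (show (-4 : ℝ) < -1.1 by norm_num) (show (-1.1 : ℝ) ≤ -0.1 by norm_num) (show (-0.1 : ℝ) < 0 by norm_num)).Dtmin -
                2 * A) * |e| + msD A₃ A₄ 2 * |y - x₀|) * (msD A₃ A₄ 1 + msD A₃ A₄ 1) +
          K₂ * (‖S - WithLp.toLp 2 (fun i => 2 * π * (m i : ℝ)) - (levelPoint μ K 0 (x₀ + θ) + levelPoint μ K 0 (x₀ + θ))‖ +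
              |e| / ((bandBounds (show (-4 : ℝ) < -1.1 by norm_num) (show (-1.1 : ℝ) ≤ -0.1 by norm_num) (show (-0.1 : ℝ) < 0 by norm_num)).Dtmin - 2 * A) +
              msD A₃ A₄ 1 * |y - x₀|) * msD A₃ A₄ 2 +
          K₁ * ((uRowTwoConst A A₃ ((bandBounds (show (-4 : ℝ) < -1.1 by norm_num) (show (-1.1 : ℝ) ≤ -0.1 by norm_num) (show (-0.1 : ℝ) < 0 by norm_num)).Dtmin -
                  2 * A) +
                1 / ((bandBounds (show (-4 : ℝ) < -1.1 by norm_num) (show (-1.1 : ℝ) ≤ -0.1 by norm_num) (show (-0.1 : ℝ) < 0 by norm_num)).Dtmin - 2 * A) +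
                2 * (radialRowOneConst A ((bandBounds (show (-4 : ℝ) < -1.1 by norm_num) (show (-1.1 : ℝ) ≤ -0.1 by norm_num)
                    (show (-0.1 : ℝ) < 0 by norm_num)).Dtmin - 2 * A) -
                  1 / ((bandBounds (show (-4 : ℝ) < -1.1 by norm_num) (show (-1.1 : ℝ) ≤ -0.1 by norm_num) (show (-0.1 : ℝ) < 0 by norm_num)).Dtmin - 2 * A))) *
              |e| + msD A₃ A₄ 3 * |y - x₀|) ≤
        w * (bandBounds (show (-4 : ℝ) < -1.1 by norm_num) (show (-1.1 : ℝ) ≤ -0.1 by norm_num) (show (-0.1 : ℝ) < 0 by norm_num)).umin ^ 2)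
    (hslope : K₂ * msD A₃ A₄ 1 * (‖S - WithLp.toLp 2 (fun i => 2 * π * (m i : ℝ)) - (2 : ℝ) • levelPoint μ K 0 (x₀ + θ)‖ +
        2 * (hi / ((bandBounds (show (-4 : ℝ) < -1.1 by norm_num) (show (-1.1 : ℝ) ≤ -0.1 by norm_num) (show (-0.1 : ℝ) < 0 by norm_num)).Dtmin - 2 * A))) ≤
      w * (bandBounds (show (-4 : ℝ) < -1.1 by norm_num) (show (-1.1 : ℝ) ≤ -0.1 by norm_num) (show (-0.1 : ℝ) < 0 by norm_num)).umin ^ 2 * Wm)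
    (hrate : K₂ * (‖S - WithLp.toLp 2 (fun i => 2 * π * (m i : ℝ)) - (2 : ℝ) • levelPoint μ K 0 (x₀ + θ)‖ +
          2 * (hi / ((bandBounds (show (-4 : ℝ) < -1.1 by norm_num) (show (-1.1 : ℝ) ≤ -0.1 by norm_num) (show (-0.1 : ℝ) < 0 by norm_num)).Dtmin - 2 * A) +
            msD A₃ A₄ 1 * Wφ)) /
        ((bandBounds (show (-4 : ℝ) < -1.1 by norm_num) (show (-1.1 : ℝ) ≤ -0.1 by norm_num) (show (-0.1 : ℝ) < 0 by norm_num)).Dtmin - 2 * A) ≤ 1 / 2)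
    (hK1 : ∀ e ∈ Icc (-lo) lo, ∀ u, |deriv (Kr e) u| ≤ (max lo |u|)⁻¹ ^ 2)
    (hw0 : ∀ e ∈ Icc (-lo) lo, 0 ≤ wt e) (hwW : ∀ e ∈ Icc (-lo) lo, wt e ≤ W) (hX0 : ∀ e ∈ Icc (-lo) lo, ∀ y ∈ Icc α β, |X e y| ≤ X₀) :
    ∫ y in α..β, |∫ e in (-lo)..lo, wt e * X e y * deriv (Kr e) (frameLevel μ K (S - levelPoint μ K e (y + θ)))| ≤
      32 * (32 * (W * X₀)) / (3 * Real.sqrt (w * (bandBounds (show (-4 : ℝ) < -1.1 by norm_num) (show (-1.1 : ℝ) ≤ -0.1 by norm_num) (show (-0.1 : ℝ) < 0 by norm_num)).umin ^ 2 / 2)) *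
        (lo * ((max |sInf ((fun x : ℝ => frameLevel μ K (S - levelPoint μ K 0 (x + θ))) '' Icc α β)| lo)⁻¹ *
          (Real.sqrt (max |sInf ((fun x : ℝ => frameLevel μ K (S - levelPoint μ K 0 (x + θ))) '' Icc α β)| lo))⁻¹)) := by
  set B := (bandBounds (show (-4 : ℝ) < -1.1 by norm_num) (show (-1.1 : ℝ) ≤ -0.1 by norm_num) (show (-0.1 : ℝ) < 0 by norm_num)) with hBdef
  set v : Momentum := WithLp.toLp 2 (fun i => 2 * π * (m i : ℝ)) with hv
  have hADt : 2 * A < B.Dtmin := by have := klCurveD_pos; linarith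
  have hDt : 0 < B.Dtmin - 2 * A := by linarith
  have hK₂0 : 0 ≤ K₂ := (norm_nonneg _).trans (hK₂ 0)
  have hu : 0 < B.umin := B.umin_pos
  have hwp : 0 < w := hG.wmin_pos
  have hc₂ : 0 < w * B.umin ^ 2 := by positivity
  have hhi0 : 0 ≤ hi := hlo0.le.trans hlohi
  have hlor : lo < r := lt_of_le_of_lt hlohi hhir
  have h0r : |(0 : ℝ)| < r := by rw [abs_zero]; exact hr
  have h0I : (0 : ℝ) ∈ Icc (-hi) hi := ⟨by linarith, hhi0⟩
  have h0J : (0 : ℝ) ∈ Icc (-lo) lo := ⟨by linarith, hlo0.le⟩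
  have hM : 0 ≤ msD A₃ A₄ 1 := (norm_nonneg _).trans (norm_iteratedDeriv_levelPoint_le hA hA20 hd hlo hhi hA₃ hA₄ h0r le_rfl (by norm_num) 0)
  have hαβ : α ≤ β := hx₀.1.trans hx₀.2
  have hX00 : 0 ≤ X₀ := (abs_nonneg _).trans (hX0 0 h0J x₀ hx₀)
  have hW0 : 0 ≤ W := (hw0 0 h0J).trans (hwW 0 h0J)
  -- the package
  obtain ⟨vs, hvs, hcurv, hinf, -, -⟩ :=
    partnerBand_foldBox_package hA hA20 hd hr hlo hhi hA₃ hA₄ hK₁ hK₂ hK₃ hG S m θ hx₀ hWα hWβ hWφ hhi0 hhir hwin hslope hrate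
  set δ₀ : ℝ := frameLevel μ K (S - levelPoint μ K 0 (vs 0 + θ)) with hδ₀def
  rw [hinf] at hδ₀ ⊢
  have hg0 : ContDiff ℝ 2 (fun x : ℝ => frameLevel μ K (S - levelPoint μ K 0 (x + θ))) := contDiff_partnerBand_angle hA hd hlo hhi S h0r θ
  have hmin : ∀ y ∈ Icc α β, δ₀ ≤ frameLevel μ K (S - levelPoint μ K 0 (y + θ)) := fun y hy =>
    le_of_fold_of_convex hg0 (hvs 0 h0I).1 (hvs 0 h0I).2 (fun t ht => hc₂.le.trans (hcurv 0 h0I t ht).1) hy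
  -- the quadratic growth of `D(y) = ē(0,y)` away from the fold point
  have hDq : ∀ y ∈ Icc α β, δ₀ + w * B.umin ^ 2 / 2 * (y - vs 0) ^ 2 ≤ frameLevel μ K (S - levelPoint μ K 0 (y + θ)) := fun y hy => by
    have h := fold_quadratic (g := fun x : ℝ => frameLevel μ K (S - levelPoint μ K 0 (x + θ))) hg0 (by positivity : 0 < w * B.umin ^ 2 / 2)
      (fun t ht => by have := (hcurv 0 h0I t ht).1; linarith) (hvs 0 h0I).1 (fun t ht => hmin t ht) hy
    rw [hδ₀def]; linarith
  -- the rate window along every line of the box, levels in the strip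
  have hratey : ∀ y ∈ Icc α β, ∀ σ ∈ Icc (-lo) lo, K₂ * ‖S - v - (2 : ℝ) • levelPoint μ K σ (y + θ)‖ / (B.Dtmin - 2 * A) ≤ 1 / 2 := by
    intro y hy σ hσ
    have hσr : |σ| < r := abs_lt.2 ⟨by linarith [hσ.1], lt_of_le_of_lt hσ.2 hlor⟩
    have hD' := norm_caustic_sub_two_smul_le hA hA20 hd hlo hhi hA₃ hA₄ S v hσr θ x₀ y
    refine le_trans ?_ hrate
    refine div_le_div_of_nonneg_right (mul_le_mul_of_nonneg_left (hD'.trans ?_) hK₂0) hDt.le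
    have h1 : |σ| / (B.Dtmin - 2 * A) ≤ hi / (B.Dtmin - 2 * A) :=
      div_le_div_of_nonneg_right (by rw [abs_le]; constructor <;> linarith [hσ.1, hσ.2]) hDt.le
    have h2 : msD A₃ A₄ 1 * |y - x₀| ≤ msD A₃ A₄ 1 * Wφ := mul_le_mul_of_nonneg_left (hWφ y hy) hM
    linarith
  -- the angle layer with `A₂ = A₃ = 0`
  have hangle := intervalIntegral_pre_caustic_angle_le
    (F := fun y => |∫ e in (-lo)..lo, wt e * X e y * deriv (Kr e) (frameLevel μ K (S - levelPoint μ K e (y + θ)))|)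
    (D := fun y => frameLevel μ K (S - levelPoint μ K 0 (y + θ)))
    (A₁ := 32 * (W * X₀)) (A₂ := 0) (A₃ := 0)
    (hvs 0 h0I).1 (by positivity : 0 < w * B.umin ^ 2 / 2) hδ₀ hlo0 (by positivity) le_rfl le_rfl (fun y _ => abs_nonneg _) hDq
    fun y hy => by
      have h := abs_levelLine_partnerBand_pre_strip_le hA hd hr hlo hhi hK₂ S m θ (hδ₀.trans_le (hmin y hy)) hlo0 hlor (hratey y hy)
        hK1 hw0 hwW (fun e he => hX0 e he y hy)
      simpa only [zero_mul, add_zero] using h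
  refine hangle.trans ?_
  -- the value in dispatch shape (`B = B′ = 0`)
  rw [abs_of_pos hδ₀]
  set m₀ := max δ₀ lo with hm₀
  have hm₀pos : 0 < m₀ := lt_max_of_lt_right hlo0
  have hsc : 0 < Real.sqrt (w * B.umin ^ 2 / 2) := Real.sqrt_pos.2 (by positivity)
  have hsm : 0 < Real.sqrt m₀ := Real.sqrt_pos.2 hm₀pos
  have hid : 2 * (32 * (W * X₀) * (16 * lo / (3 * Real.sqrt (w * B.umin ^ 2 / 2) * (m₀ * Real.sqrt m₀)))) =
      32 * (32 * (W * X₀)) / (3 * Real.sqrt (w * B.umin ^ 2 / 2)) * (lo * (m₀⁻¹ * (Real.sqrt m₀)⁻¹)) := by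
    field_simp
    ring
  simp only [zero_mul, mul_zero, add_zero]
  rw [hid]

end Sizes

end Summit.HubbardSuperconductivity.HubbardSuperconductivity.Theorems.C4a

end
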